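import Literature.AlgebraicGeometry.Resolution.MonoidalPerron
import Literature.AlgebraicGeometry.Resolution.MonoidalEFReductionTracked
import HarnessLib

/-!
# [CoP1] Prop. 8.1: the reduction `♯E = ♯F ≤ r` by Lemma 8.2 (Perron) and one unit step, IN THE FRAME

Topic: `Literature/AlgebraicGeometry/Resolution`. PROOF side of `CossartPiltant2019ReductionP`
(`ArithmeticalThreefoldsLocal.lean`), input (C4): the head of the decomposition layer of
[CoP1] Prop. 9.3 is [CoP1] Prop. 8.1 (`exists_localUniformization_of_head'`,
`DecompositionLayerStrictParameters.lean`). After the reduction `E = F`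
(`MonoidalEFReductionTracked.lean`) the printed proof (V. Cossart, O. Piltant, HAL
hal-00139124, p. 23) continues:

> Suppose that `♯(E) > r` … By lemma 8.2 below, there exists … a sequence of monoidal
> transforms along `W` … such that `W y_{i_n}⁽ⁿ⁻¹⁾ = W y_{i′_n}⁽ⁿ⁻¹⁾` and `S₂⁽ⁿ⁾` is the
> monoidal transform of `S₂⁽ⁿ⁻¹⁾` at `(y_{i_n}⁽ⁿ⁻¹⁾, y_{i′_n}⁽ⁿ⁻¹⁾)` along `W`. Note that
> `S = S₂⁽ⁿ⁾` still has property (1) of the proposition. By construction, the corresponding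
> subsets `E⁽ⁿ⁾, F⁽ⁿ⁾` of `{1, 2, 3}` satisfy `E⁽ⁿ⁾ = F⁽ⁿ⁾ ⊂ E`. Therefore we can achieve a
> reduction of `♯(E)` if `♯(E) > r`.

This file PROVES this loop in the frame (`exists_frameStepsTracked_card_supp_le`): from a
tracked state with `f = u ∏ x^α`, `h = w ∏ x^β`, `supp α = supp β = E`, and a SUPPLIER of
non-trivial multiplicative relations among the values of any family of more than `r` nonzero
elements indexed inside `Fin d` (`hdep`: "the rational rank of `W` is `≤ r`", the printed
"`W y₁, …, W y_r` generate `W L ⊗ ℚ`"), finitely many monoidal transforms along `O` — Lemma 8.2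
(`exists_frameStepsTracked_valuation_eq`, `MonoidalPerron.lean`) followed by the unit step
`exists_frameStepTracked_of_valuation_eq_one` at the pair of equal values — reach a tracked
state with `supp α′ = supp β′` of cardinality `≤ r`.

Everything is PROVED; no named facts, definitions, instances or notation are introduced.

## Sources

* V. Cossart, O. Piltant, J. Algebra 320 (2008) 1051–1082: proof of Prop. 8.1 and Lemma 8.2
  (HAL hal-00139124, pp. 22–23). [CossartPiltant2008]
-/

noncomputable section

namespace Literature.AlgebraicGeometry.Resolution

universe u

open IsLocalRing _root_.Polynomial Function

section SupportReduction

variable {S : Type u} [CommRing S] [IsDomain S] [IsLocalRing S] {E : Type u} [Field E]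
  [Algebra S E] [Algebra.IsAlgebraic S E]
  (hSuc : IsUniversallyCatenaryRing S) (hinj : Function.Injective (algebraMap S E))
  (O : ValuationSubring E) (hSO : ∀ s : S, algebraMap S E s ∈ O)
  (hdom : ∀ s ∈ maximalIdeal S, O.valuation (algebraMap S E s) < 1)
  (hres : ∀ y : O, ∃ q : S[X], (∃ i, q.coeff i ∉ maximalIdeal S) ∧
    O.valuation (q.eval₂ (algebraMap S E) y) < 1)
  {d : ℕ} (hSdim : ringKrullDim S = d)
  (R₀ : Subring E) (hSR₀ : ∀ s : S, algebraMap S E s ∈ R₀)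

set_option maxHeartbeats 1600000 in
include hSuc hinj hSO hdom hres hSdim hSR₀ in
/-- **[CoP1] Prop. 8.1, the reduction `♯E = ♯F ≤ r`** (HAL p. 23: "Therefore we can achieve
a reduction of `♯(E)` if `♯(E) > r`"), in the frame and tracked. Given `r` and a supplier
`hdep` of a non-trivial relation `∏ v(y_k)^{c_k⁺} = ∏ v(y_k)^{c_k⁻}` (`c ≠ 0` supported on
`I`) for every family `y` of nonzero elements and every index set `I` with `♯I > r` (the
rational rank of the valuation is at most `r`): from a regular `R_t` with regular parameters
`x`, `fⁿ t ⊆ R₀`, `f = u ∏ x^α`, `h = w ∏ x^β` (`v(u) = v(w) = 0`) and `supp α = supp β`,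
finitely many monoidal transforms along `O` (Lemma 8.2, then the transform at the two
parameters of equal value, whose quotient is a unit) reach a regular `R_{t′} ⊇ R_t`,
`fⁿ t′ ⊆ R₀`, with regular parameters `x′` in which `f`, `h` are units times monomials with
`supp α′ = supp β′` of cardinality `≤ r`. [cite: CossartPiltant2008, proof of Prop. 8.1 (HAL p. 23)] -/
theorem exists_frameStepsTracked_card_supp_le (f : E) (hfR₀ : f ∈ R₀) (r : ℕ)
    (hdep : ∀ (I : Finset (Fin d)) (y : Fin d → E), r < I.card → (∀ k, y k ≠ 0) →
      ∃ c : Fin d → ℤ, (∀ k, k ∉ I → c k = 0) ∧ c ≠ 0 ∧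
        ∏ k, O.valuation (y k) ^ (c k).toNat = ∏ k, O.valuation (y k) ^ (-c k).toNat)
    (n : ℕ) :
    ∀ (t : Set E) (_ : t.Finite) (_ : ∀ y ∈ t, ∃ n : ℕ, f ^ n * y ∈ R₀)
      (hTO : (Algebra.adjoin S t).toSubring ≤ O.toSubring)
      (_ : IsRegularLocalRing (locAtCentre (Algebra.adjoin S t).toSubring O))
      (x : Fin d → locAtCentre (Algebra.adjoin S t).toSubring O)
      (_ : haveI := isLocalRing_locAtCentre hTO
        Ideal.span (Set.range x) = maximalIdeal _)
      (h u w : E) (_ : u ∈ locAtCentre (Algebra.adjoin S t).toSubring O)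
      (_ : O.valuation u = 1) (_ : w ∈ locAtCentre (Algebra.adjoin S t).toSubring O)
      (_ : O.valuation w = 1) (α β : Fin d → ℕ)
      (_ : f = u * ∏ c, (x c : E) ^ α c) (_ : h = w * ∏ c, (x c : E) ^ β c)
      (_ : ∀ c, 0 < α c ↔ 0 < β c)
      (_ : (Finset.univ.filter (fun c => 0 < α c)).card ≤ r + n),
    ∃ (t' : Set E), t ⊆ t' ∧ t'.Finite ∧ (∀ y ∈ t', ∃ n : ℕ, f ^ n * y ∈ R₀) ∧
      ∃ (hT'O : (Algebra.adjoin S t').toSubring ≤ O.toSubring),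
        IsRegularLocalRing (locAtCentre (Algebra.adjoin S t').toSubring O) ∧
        locAtCentre (Algebra.adjoin S t).toSubring O ≤
          locAtCentre (Algebra.adjoin S t').toSubring O ∧
        ∃ (x' : Fin d → locAtCentre (Algebra.adjoin S t').toSubring O) (u' w' : E)
          (α' β' : Fin d → ℕ),
          (haveI := isLocalRing_locAtCentre hT'O
           Ideal.span (Set.range x') = maximalIdeal _) ∧
          u' ∈ locAtCentre (Algebra.adjoin S t').toSubring O ∧ O.valuation u' = 1 ∧
          w' ∈ locAtCentre (Algebra.adjoin S t').toSubring O ∧ O.valuation w' = 1 ∧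
          f = u' * ∏ c, (x' c : E) ^ α' c ∧ h = w' * ∏ c, (x' c : E) ^ β' c ∧
          (∀ c, 0 < α' c ↔ 0 < β' c) ∧
          (Finset.univ.filter (fun c => 0 < α' c)).card ≤ r := by
  classical
  induction n with
  | zero =>
    intro t ht hTR hTO hreg x hx h u w huR hvu hwR hvw α β hf hh hEF hcard
    exact ⟨t, le_rfl, ht, hTR, hTO, hreg, le_rfl, x, u, w, α, β, hx, huR, hvu, hwR, hvw, hf, hh,
      hEF, hcard⟩
  | succ k ih =>
    intro t ht hTR hTO hreg x hx h u w huR hvu hwR hvw α β hf hh hEF hcard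
    by_cases hle : (Finset.univ.filter (fun c => 0 < α c)).card ≤ r + k
    · exact ih t ht hTR hTO hreg x hx h u w huR hvu hwR hvw α β hf hh hEF hle
    -- `♯E > r`: a relation among the values of the `x_k`, `k ∈ E`
    set I : Finset (Fin d) := Finset.univ.filter (fun c => 0 < α c) with hIdef
    have hIcard : r < I.card := by omega
    have hIα : ∀ k ∈ I, 0 < α k := fun k hk => (Finset.mem_filter.mp hk).2
    have hx0 : ∀ k, (x k : E) ≠ 0 := fun k =>
      coe_rsop_ne_zero_of_frame hSuc hinj O hSO hdom hres hSdim t ht hTO hreg x hx k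
    obtain ⟨c, hcI, hc0, hrel⟩ := hdep I (fun k => (x k : E)) hIcard hx0
    -- Lemma 8.2: reach two parameters of equal value
    obtain ⟨t₁, htt₁, ht₁, hTR₁, hT₁O, hreg₁, hsub₁, x₁, hspan₁, hx₁off, ⟨T, hTmono, hTle, hToff⟩,
      i, hiI, i', hi'I, hii', hvii'⟩ :=
      exists_frameStepsTracked_valuation_eq hSuc hinj O hSO hdom hres hSdim R₀ hSR₀ f hfR₀ I _ t
        ht hTR hTO hreg x hx u huR α hIα hf (fun k => (c k).toNat) (fun k => (-c k).toNat) c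
        (fun k => (Int.toNat_sub_toNat_neg (c k)).symm) hcI hc0 hrel rfl
    -- supports are unchanged by the Perron moves
    have hTα : ∀ k, 0 < T α k ↔ 0 < α k := fun k => by
      refine ⟨fun hk => ?_, fun hk => lt_of_lt_of_le hk (hTle α k)⟩
      by_cases hkI : k ∈ I
      · exact hIα k hkI
      · rw [hToff α k hkI] at hk; exact hk
    have hTβ : ∀ k, 0 < T β k ↔ 0 < β k := fun k => by
      refine ⟨fun hk => ?_, fun hk => lt_of_lt_of_le hk (hTle β k)⟩
      by_cases hkI : k ∈ I
      · exact (hEF k).mp (hIα k hkI)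
      · rw [hToff β k hkI] at hk; exact hk
    have hf₁ : f = u * ∏ c, (x₁ c : E) ^ T α c := by rw [hf, hTmono α]
    have hh₁ : h = w * ∏ c, (x₁ c : E) ^ T β c := by rw [hh, hTmono β]
    -- the unit step at `(x_i, x_{i'})`: `z = x_{i'} / x_i` has value `0`
    have hx₁0 : ∀ k, (x₁ k : E) ≠ 0 := fun k =>
      coe_rsop_ne_zero_of_frame hSuc hinj O hSO hdom hres hSdim t₁ ht₁ hT₁O hreg₁ x₁ hspan₁ k
    have h1 : O.valuation ((x₁ i' : E) / (x₁ i : E)) = 1 := by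
      rw [map_div₀, ← hvii', div_self]
      exact fun h0 => hx₁0 i ((Valuation.zero_iff _).mp h0)
    have hzf : (x₁ i' : E) / (x₁ i : E) * f ∈ locAtCentre (Algebra.adjoin S t₁).toSubring O :=
      div_mul_monomial_mem_locAtCentre O t₁ x₁ f u (hsub₁ huR) (T α) hf₁ i i'
        ((hTα i).mpr (hIα i hiI)) (hx₁0 i)
    set z : E := (x₁ i' : E) / (x₁ i : E) with hzdef
    obtain ⟨t₂, ht₁t₂, ht₂, hTR₂, hT₂O, hreg₂, hzR, x₂, hx₂c, hspan₂, hmono₂⟩ :=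
      exists_frameStepTracked_of_valuation_eq_one hSuc hinj O hSO hdom hres hSdim R₀ hSR₀ f hfR₀
        t₁ ht₁ hTR₁ hT₁O hreg₁ x₁ hspan₁ i i' hii' h1 hzf
    have hsub₂ : locAtCentre (Algebra.adjoin S t₁).toSubring O ≤
        locAtCentre (Algebra.adjoin S t₂).toSubring O :=
      locAtCentre_mono O (fun y hy => Algebra.adjoin_mono ht₁t₂ hy)
    -- the new exponents: `i'` leaves `E` and `F`
    set α₂ : Fin d → ℕ := update (update (T α) i (T α i + T α i')) i' 0 with hα₂def
    set β₂ : Fin d → ℕ := update (update (T β) i (T β i + T β i')) i' 0 with hβ₂def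
    have hsuppα₂ : ∀ k, 0 < α₂ k ↔ (k ≠ i' ∧ 0 < α k) := fun k => by
      by_cases hk' : k = i'
      · subst hk'; simp only [hα₂def, update_self, lt_self_iff_false, ne_eq, not_true_eq_false,
          false_and]
      · rw [hα₂def, update_of_ne hk']
        by_cases hk : k = i
        · subst hk
          rw [update_self]
          exact ⟨fun _ => ⟨hk', hIα k hiI⟩,
            fun _ => Nat.add_pos_left ((hTα k).mpr (hIα k hiI)) _⟩
        · rw [update_of_ne hk, hTα k]
          exact ⟨fun hp => ⟨hk', hp⟩, fun hp => hp.2⟩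
    have hsuppβ₂ : ∀ k, 0 < β₂ k ↔ (k ≠ i' ∧ 0 < β k) := fun k => by
      by_cases hk' : k = i'
      · subst hk'; simp only [hβ₂def, update_self, lt_self_iff_false, ne_eq, not_true_eq_false,
          false_and]
      · rw [hβ₂def, update_of_ne hk']
        by_cases hk : k = i
        · subst hk
          rw [update_self]
          exact ⟨fun _ => ⟨hk', (hEF k).mp (hIα k hiI)⟩,
            fun _ => Nat.add_pos_left ((hTβ k).mpr ((hEF k).mp (hIα k hiI))) _⟩
        · rw [update_of_ne hk, hTβ k]
          exact ⟨fun hp => ⟨hk', hp⟩, fun hp => hp.2⟩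
    have hEF₂ : ∀ k, 0 < α₂ k ↔ 0 < β₂ k := fun k => by
      rw [hsuppα₂, hsuppβ₂, hEF k]
    have hcard₂ : (Finset.univ.filter (fun c => 0 < α₂ c)).card ≤ r + k := by
      have hEq : Finset.univ.filter (fun c => 0 < α₂ c) = I.erase i' := by
        ext c
        simp only [Finset.mem_filter, Finset.mem_univ, true_and, Finset.mem_erase, hIdef,
          hsuppα₂]
      rw [hEq, Finset.card_erase_of_mem hi'I]
      omega
    obtain ⟨t₃, ht₂t₃, ht₃, hTR₃, hT₃O, hreg₃, hsub₃, x₃, u₃, w₃, α₃, β₃, hspan₃, hu₃R, hvu₃, hw₃R,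
      hvw₃, hf₃, hh₃, hEF₃, hcard₃⟩ :=
      ih t₂ ht₂ hTR₂ hT₂O hreg₂ x₂ hspan₂ h (u * z ^ T α i') (w * z ^ T β i')
        (Subring.mul_mem _ (hsub₂ (hsub₁ huR)) (Subring.pow_mem _ hzR _))
        (by rw [map_mul, map_pow, hvu, h1, one_pow, one_mul])
        (Subring.mul_mem _ (hsub₂ (hsub₁ hwR)) (Subring.pow_mem _ hzR _))
        (by rw [map_mul, map_pow, hvw, h1, one_pow, one_mul]) α₂ β₂
        (by rw [hf₁, hmono₂ (T α), mul_assoc]) (by rw [hh₁, hmono₂ (T β), mul_assoc]) hEF₂ hcard₂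
    exact ⟨t₃, htt₁.trans (ht₁t₂.trans ht₂t₃), ht₃, hTR₃, hT₃O, hreg₃,
      hsub₁.trans (hsub₂.trans hsub₃), x₃, u₃, w₃, α₃, β₃, hspan₃, hu₃R, hvu₃, hw₃R, hvw₃, hf₃, hh₃,
      hEF₃, hcard₃⟩

/-! ### The same, confined to a subfield (for `t′ ⊆ K′` in the head of [CoP1] Prop. 9.3) -/

set_option maxHeartbeats 1600000 in
include hSuc hinj hSO hdom hres hSdim hSR₀ in
/-- `exists_frameStepsTracked_card_supp_le` (the loop `♯E = ♯F ≤ r`), with the new generators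
confined to a subfield `F ⊇ S ∪ t`. [cite: CossartPiltant2008, proof of Prop. 8.1 (HAL p. 23)] -/
theorem exists_frameStepsTracked_card_supp_le_subset (f : E) (hfR₀ : f ∈ R₀)
    (F : Subfield E) (hSF : ∀ s : S, algebraMap S E s ∈ F) (r : ℕ)
    (hdep : ∀ (I : Finset (Fin d)) (y : Fin d → E), r < I.card → (∀ k, y k ≠ 0) →
      ∃ c : Fin d → ℤ, (∀ k, k ∉ I → c k = 0) ∧ c ≠ 0 ∧
        ∏ k, O.valuation (y k) ^ (c k).toNat = ∏ k, O.valuation (y k) ^ (-c k).toNat)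
    (n : ℕ) :
    ∀ (t : Set E) (_ : t.Finite) (_ : t ⊆ F) (_ : ∀ y ∈ t, ∃ n : ℕ, f ^ n * y ∈ R₀)
      (hTO : (Algebra.adjoin S t).toSubring ≤ O.toSubring)
      (_ : IsRegularLocalRing (locAtCentre (Algebra.adjoin S t).toSubring O))
      (x : Fin d → locAtCentre (Algebra.adjoin S t).toSubring O)
      (_ : haveI := isLocalRing_locAtCentre hTO
        Ideal.span (Set.range x) = maximalIdeal _)
      (h u w : E) (_ : u ∈ locAtCentre (Algebra.adjoin S t).toSubring O)
      (_ : O.valuation u = 1) (_ : w ∈ locAtCentre (Algebra.adjoin S t).toSubring O)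
      (_ : O.valuation w = 1) (α β : Fin d → ℕ)
      (_ : f = u * ∏ c, (x c : E) ^ α c) (_ : h = w * ∏ c, (x c : E) ^ β c)
      (_ : ∀ c, 0 < α c ↔ 0 < β c)
      (_ : (Finset.univ.filter (fun c => 0 < α c)).card ≤ r + n),
    ∃ (t' : Set E), t ⊆ t' ∧ t'.Finite ∧ t' ⊆ F ∧ (∀ y ∈ t', ∃ n : ℕ, f ^ n * y ∈ R₀) ∧
      ∃ (hT'O : (Algebra.adjoin S t').toSubring ≤ O.toSubring),
        IsRegularLocalRing (locAtCentre (Algebra.adjoin S t').toSubring O) ∧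
        locAtCentre (Algebra.adjoin S t).toSubring O ≤
          locAtCentre (Algebra.adjoin S t').toSubring O ∧
        ∃ (x' : Fin d → locAtCentre (Algebra.adjoin S t').toSubring O) (u' w' : E)
          (α' β' : Fin d → ℕ),
          (haveI := isLocalRing_locAtCentre hT'O
           Ideal.span (Set.range x') = maximalIdeal _) ∧
          u' ∈ locAtCentre (Algebra.adjoin S t').toSubring O ∧ O.valuation u' = 1 ∧
          w' ∈ locAtCentre (Algebra.adjoin S t').toSubring O ∧ O.valuation w' = 1 ∧
          f = u' * ∏ c, (x' c : E) ^ α' c ∧ h = w' * ∏ c, (x' c : E) ^ β' c ∧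
          (∀ c, 0 < α' c ↔ 0 < β' c) ∧
          (Finset.univ.filter (fun c => 0 < α' c)).card ≤ r := by
  classical
  induction n with
  | zero =>
    intro t ht htF hTR hTO hreg x hx h u w huR hvu hwR hvw α β hf hh hEF hcard
    exact ⟨t, le_rfl, ht, htF, hTR, hTO, hreg, le_rfl, x, u, w, α, β, hx, huR, hvu, hwR, hvw, hf,
      hh, hEF, hcard⟩
  | succ k ih =>
    intro t ht htF hTR hTO hreg x hx h u w huR hvu hwR hvw α β hf hh hEF hcard
    by_cases hle : (Finset.univ.filter (fun c => 0 < α c)).card ≤ r + k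
    · exact ih t ht htF hTR hTO hreg x hx h u w huR hvu hwR hvw α β hf hh hEF hle
    -- `♯E > r`: a relation among the values of the `x_k`, `k ∈ E`
    set I : Finset (Fin d) := Finset.univ.filter (fun c => 0 < α c) with hIdef
    have hIcard : r < I.card := by omega
    have hIα : ∀ k ∈ I, 0 < α k := fun k hk => (Finset.mem_filter.mp hk).2
    have hx0 : ∀ k, (x k : E) ≠ 0 := fun k =>
      coe_rsop_ne_zero_of_frame hSuc hinj O hSO hdom hres hSdim t ht hTO hreg x hx k
    obtain ⟨c, hcI, hc0, hrel⟩ := hdep I (fun k => (x k : E)) hIcard hx0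
    -- Lemma 8.2: reach two parameters of equal value
    obtain ⟨t₁, htt₁, ht₁, ht₁F, hTR₁, hT₁O, hreg₁, hsub₁, x₁, hspan₁, hx₁off,
      ⟨T, hTmono, hTle, hToff⟩, i, hiI, i', hi'I, hii', hvii'⟩ :=
      exists_frameStepsTracked_valuation_eq_subset hSuc hinj O hSO hdom hres hSdim R₀ hSR₀ f hfR₀ F
        hSF I _ t ht htF hTR hTO hreg x hx u huR α hIα hf (fun k => (c k).toNat)
        (fun k => (-c k).toNat) c (fun k => (Int.toNat_sub_toNat_neg (c k)).symm) hcI hc0 hrel rfl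
    -- supports are unchanged by the Perron moves
    have hTα : ∀ k, 0 < T α k ↔ 0 < α k := fun k => by
      refine ⟨fun hk => ?_, fun hk => lt_of_lt_of_le hk (hTle α k)⟩
      by_cases hkI : k ∈ I
      · exact hIα k hkI
      · rw [hToff α k hkI] at hk; exact hk
    have hTβ : ∀ k, 0 < T β k ↔ 0 < β k := fun k => by
      refine ⟨fun hk => ?_, fun hk => lt_of_lt_of_le hk (hTle β k)⟩
      by_cases hkI : k ∈ I
      · exact (hEF k).mp (hIα k hkI)
      · rw [hToff β k hkI] at hk; exact hk
    have hf₁ : f = u * ∏ c, (x₁ c : E) ^ T α c := by rw [hf, hTmono α]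
    have hh₁ : h = w * ∏ c, (x₁ c : E) ^ T β c := by rw [hh, hTmono β]
    -- the unit step at `(x_i, x_{i'})`: `z = x_{i'} / x_i` has value `0`
    have hx₁0 : ∀ k, (x₁ k : E) ≠ 0 := fun k =>
      coe_rsop_ne_zero_of_frame hSuc hinj O hSO hdom hres hSdim t₁ ht₁ hT₁O hreg₁ x₁ hspan₁ k
    have h1 : O.valuation ((x₁ i' : E) / (x₁ i : E)) = 1 := by
      rw [map_div₀, ← hvii', div_self]
      exact fun h0 => hx₁0 i ((Valuation.zero_iff _).mp h0)
    have hzf : (x₁ i' : E) / (x₁ i : E) * f ∈ locAtCentre (Algebra.adjoin S t₁).toSubring O :=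
      div_mul_monomial_mem_locAtCentre O t₁ x₁ f u (hsub₁ huR) (T α) hf₁ i i'
        ((hTα i).mpr (hIα i hiI)) (hx₁0 i)
    set z : E := (x₁ i' : E) / (x₁ i : E) with hzdef
    obtain ⟨t₂, ht₁t₂, ht₂, ht₂F, hTR₂, hT₂O, hreg₂, hzR, x₂, hx₂c, hspan₂, hmono₂⟩ :=
      exists_frameStepTracked_of_valuation_eq_one_subset hSuc hinj O hSO hdom hres hSdim R₀ hSR₀ f
        hfR₀ F hSF t₁ ht₁ ht₁F hTR₁ hT₁O hreg₁ x₁ hspan₁ i i' hii' h1 hzf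
    have hsub₂ : locAtCentre (Algebra.adjoin S t₁).toSubring O ≤
        locAtCentre (Algebra.adjoin S t₂).toSubring O :=
      locAtCentre_mono O (fun y hy => Algebra.adjoin_mono ht₁t₂ hy)
    -- the new exponents: `i'` leaves `E` and `F`
    set α₂ : Fin d → ℕ := update (update (T α) i (T α i + T α i')) i' 0 with hα₂def
    set β₂ : Fin d → ℕ := update (update (T β) i (T β i + T β i')) i' 0 with hβ₂def
    have hsuppα₂ : ∀ k, 0 < α₂ k ↔ (k ≠ i' ∧ 0 < α k) := fun k => by
      by_cases hk' : k = i'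
      · subst hk'; simp only [hα₂def, update_self, lt_self_iff_false, ne_eq, not_true_eq_false,
          false_and]
      · rw [hα₂def, update_of_ne hk']
        by_cases hk : k = i
        · subst hk
          rw [update_self]
          exact ⟨fun _ => ⟨hk', hIα k hiI⟩,
            fun _ => Nat.add_pos_left ((hTα k).mpr (hIα k hiI)) _⟩
        · rw [update_of_ne hk, hTα k]
          exact ⟨fun hp => ⟨hk', hp⟩, fun hp => hp.2⟩
    have hsuppβ₂ : ∀ k, 0 < β₂ k ↔ (k ≠ i' ∧ 0 < β k) := fun k => by
      by_cases hk' : k = i'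
      · subst hk'; simp only [hβ₂def, update_self, lt_self_iff_false, ne_eq, not_true_eq_false,
          false_and]
      · rw [hβ₂def, update_of_ne hk']
        by_cases hk : k = i
        · subst hk
          rw [update_self]
          exact ⟨fun _ => ⟨hk', (hEF k).mp (hIα k hiI)⟩,
            fun _ => Nat.add_pos_left ((hTβ k).mpr ((hEF k).mp (hIα k hiI))) _⟩
        · rw [update_of_ne hk, hTβ k]
          exact ⟨fun hp => ⟨hk', hp⟩, fun hp => hp.2⟩
    have hEF₂ : ∀ k, 0 < α₂ k ↔ 0 < β₂ k := fun k => by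
      rw [hsuppα₂, hsuppβ₂, hEF k]
    have hcard₂ : (Finset.univ.filter (fun c => 0 < α₂ c)).card ≤ r + k := by
      have hEq : Finset.univ.filter (fun c => 0 < α₂ c) = I.erase i' := by
        ext c
        simp only [Finset.mem_filter, Finset.mem_univ, true_and, Finset.mem_erase, hIdef,
          hsuppα₂]
      rw [hEq, Finset.card_erase_of_mem hi'I]
      omega
    obtain ⟨t₃, ht₂t₃, ht₃, ht₃F, hTR₃, hT₃O, hreg₃, hsub₃, x₃, u₃, w₃, α₃, β₃, hspan₃, hu₃R, hvu₃,
      hw₃R, hvw₃, hf₃, hh₃, hEF₃, hcard₃⟩ :=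
      ih t₂ ht₂ ht₂F hTR₂ hT₂O hreg₂ x₂ hspan₂ h (u * z ^ T α i') (w * z ^ T β i')
        (Subring.mul_mem _ (hsub₂ (hsub₁ huR)) (Subring.pow_mem _ hzR _))
        (by rw [map_mul, map_pow, hvu, h1, one_pow, one_mul])
        (Subring.mul_mem _ (hsub₂ (hsub₁ hwR)) (Subring.pow_mem _ hzR _))
        (by rw [map_mul, map_pow, hvw, h1, one_pow, one_mul]) α₂ β₂
        (by rw [hf₁, hmono₂ (T α), mul_assoc]) (by rw [hh₁, hmono₂ (T β), mul_assoc]) hEF₂ hcard₂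
    exact ⟨t₃, htt₁.trans (ht₁t₂.trans ht₂t₃), ht₃, ht₃F, hTR₃, hT₃O, hreg₃,
      hsub₁.trans (hsub₂.trans hsub₃), x₃, u₃, w₃, α₃, β₃, hspan₃, hu₃R, hvu₃, hw₃R, hvw₃, hf₃, hh₃,
      hEF₃, hcard₃⟩


end SupportReduction

end Literature.AlgebraicGeometry.Resolution

end
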